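import Summits.CriticalPhenomena.CardyFormulaZ2.Theorems.CardyBondTriangularBondTriangularBoxCrossingSteps
import Summits.CriticalPhenomena.CardyFormulaZ2.Theorems.CardyBondTriangularBondTriangularBoxCrossingState
import Literature.Probability.LatticeModels.TriangularLattice
import HarnessLib

/-!
# Route CardyBondTriangular — item `BondTriangularBoxCrossing`: each step of the sweep is a valid move

For a state `σ = (j, a, k)` of the sweep (`StepHyp`), with `m = j + 2k` the level of the current
face `(a − k, m)`:

* `m ≤ N − 2`: the weights at `σ.succ` are obtained from those at `σ` by the double step at the
  up-face `(a−k, m)` (`connEquiv_weight_succ_double`, via `connEquiv_doubleStep`);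
* `m = N − 1`: by the half step (`connEquiv_weight_succ_half`, via `connEquiv_halfStep`);
* `m = N`: by deleting the travelling edge, so the weights decrease (`weight_succ_le`).

All hypotheses of the abstract move lemmas are discharged from the closed form of the weights
(`weight_pt_pt`) and the step facts of the state file.
-/

noncomputable section

namespace Summit.CriticalPhenomena.CardyFormulaZ2.Theorems.TriSweep

open Literature.Probability.LatticeModels Literature.Probability.Percolation
open Literature.Probability.Percolation.StarTriangle

variable (C : Cfg) (t : unitInterval)

section Values

variable {C}

/-! ### Values of the slot weights -/

/-- A live horizontal slot inside the box carries `t`. -/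
theorem wH_eq_t {σ : St} {b m : ℤ} (h1 : C.InBox b m) (h2 : C.InBox (b + 1) m) (h3 : AliveH C σ b m) :
    wH C t σ b m = t := by
  simp [wH, h1, h2, h3]

/-- A dead horizontal slot carries `0`. -/
theorem wH_eq_zero {σ : St} {b m : ℤ} (h : ¬ AliveH C σ b m) : wH C t σ b m = 0 := by
  simp [wH, h]

/-- A horizontal slot not inside the box carries `0`. -/
theorem wH_eq_zero' {σ : St} {b m : ℤ} (h : ¬ (C.InBox b m ∧ C.InBox (b + 1) m)) :
    wH C t σ b m = 0 := by
  unfold wH; rw [if_neg]; tauto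

/-- An unflagged `v`-slot inside the box carries `t`. -/
theorem wV_eq_t {σ : St} {b m : ℤ} (h1 : C.InBox b m) (h2 : C.InBox b (m + 1)) (h3 : ¬ FlagV C σ b m) :
    wV C t σ b m = t := by
  simp [wV, h1, h2, h3]

/-- A flagged `v`-slot inside the box carries `1 − t`. -/
theorem wV_eq_symm {σ : St} {b m : ℤ} (h1 : C.InBox b m) (h2 : C.InBox b (m + 1)) (h3 : FlagV C σ b m) :
    wV C t σ b m = unitInterval.symm t := by
  simp [wV, h1, h2, h3]

/-- A `v`-slot not inside the box carries `0`. -/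
theorem wV_eq_zero {σ : St} {b m : ℤ} (h : ¬ (C.InBox b m ∧ C.InBox b (m + 1))) : wV C t σ b m = 0 := by
  unfold wV; rw [if_neg h]

/-- An unflagged `d`-slot inside the box carries `t`. -/
theorem wD_eq_t {σ : St} {b m : ℤ} (h1 : C.InBox (b + 1) m) (h2 : C.InBox b (m + 1))
    (h3 : ¬ FlagD C σ b m) : wD C t σ b m = t := by
  simp [wD, h1, h2, h3]

/-- A flagged `d`-slot inside the box carries `1 − t`. -/
theorem wD_eq_symm {σ : St} {b m : ℤ} (h1 : C.InBox (b + 1) m) (h2 : C.InBox b (m + 1))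
    (h3 : FlagD C σ b m) : wD C t σ b m = unitInterval.symm t := by
  simp [wD, h1, h2, h3]

/-- A `d`-slot not inside the box carries `0`. -/
theorem wD_eq_zero {σ : St} {b m : ℤ} (h : ¬ (C.InBox (b + 1) m ∧ C.InBox b (m + 1))) :
    wD C t σ b m = 0 := by
  unfold wD; rw [if_neg h]

/-- The weight of a pair one of whose endpoints is outside the label box vanishes. -/
theorem weight_eq_zero_of_not_inBox (σ : St) {b m : ℤ} (h : ¬ C.InBox b m) (z : Site 2) :
    weight C t σ s(pt b m, z) = 0 := by
  rw [← pt_eta z, weight_pt_pt]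
  split_ifs with h1 h2 h3 h4 h5 h6
  · exact wH_eq_zero' t (fun hh => h hh.1)
  · obtain ⟨rfl, rfl⟩ := h2; exact wH_eq_zero' t (fun hh => h hh.2)
  · exact wV_eq_zero t (fun hh => h hh.1)
  · obtain ⟨rfl, rfl⟩ := h4; exact wV_eq_zero t (fun hh => h hh.2)
  · obtain ⟨rfl, -⟩ := h5; exact wD_eq_zero t (fun hh => h hh.1)
  · obtain ⟨-, rfl⟩ := h6; exact wD_eq_zero t (fun hh => h hh.2)
  · rfl

/-- The spare label is isolated at every state. -/
theorem weight_spare (σ : St) (z : Site 2) : weight C t σ s(spare C, z) = 0 :=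
  weight_eq_zero_of_not_inBox t σ (fun h => by simp only [Cfg.InBox, Cfg.Bhi] at h; omega) z

/-! ### Invariance of the untouched slots along a step -/

variable {σ : St} (H : StepHyp C σ)
include H

/-- The horizontal slots other than the current one and its target keep their weight. -/
theorem StepHyp.wH_succ {b m : ℤ} (h1 : ¬ (b = σ.a - σ.k ∧ m = σ.j + 2 * σ.k))
    (h2 : ¬ (b = σ.a - σ.k - 1 ∧ m = σ.j + 2 * σ.k + 2)) : wH C t σ.succ b m = wH C t σ b m := by
  unfold wH
  by_cases h : C.InBox b m ∧ C.InBox (b + 1) m ∧ AliveH C σ b m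
  · rw [if_pos h, if_pos ⟨h.1, h.2.1, (H.aliveH_succ_iff h1 h2).2 h.2.2⟩]
  · rw [if_neg h, if_neg (fun h' => h ⟨h'.1, h'.2.1, (H.aliveH_succ_iff h1 h2).1 h'.2.2⟩)]

/-- The `v`-slots other than the two at the current face keep their weight. -/
theorem StepHyp.wV_succ {b m : ℤ} (h1 : ¬ (b = σ.a - σ.k ∧ m = σ.j + 2 * σ.k))
    (h2 : ¬ (b = σ.a - σ.k ∧ m = σ.j + 2 * σ.k + 1)) : wV C t σ.succ b m = wV C t σ b m := by
  unfold wV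
  by_cases hin : C.InBox b m ∧ C.InBox b (m + 1)
  · rw [if_pos hin, if_pos hin]
    by_cases hf : FlagV C σ b m
    · rw [if_pos hf, if_pos ((H.flagV_succ_iff h1 h2).2 hf)]
    · rw [if_neg hf, if_neg (fun h => hf ((H.flagV_succ_iff h1 h2).1 h))]
  · rw [if_neg hin, if_neg hin]

/-- The `d`-slots other than the two at the current face keep their weight. -/
theorem StepHyp.wD_succ {b m : ℤ} (h1 : ¬ (b = σ.a - σ.k ∧ m = σ.j + 2 * σ.k))
    (h2 : ¬ (b = σ.a - σ.k - 1 ∧ m = σ.j + 2 * σ.k + 1)) : wD C t σ.succ b m = wD C t σ b m := by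
  unfold wD
  by_cases hin : C.InBox (b + 1) m ∧ C.InBox b (m + 1)
  · rw [if_pos hin, if_pos hin]
    by_cases hf : FlagD C σ b m
    · rw [if_pos hf, if_pos ((H.flagD_succ_iff h1 h2).2 hf)]
    · rw [if_neg hf, if_neg (fun h => hf ((H.flagD_succ_iff h1 h2).1 h))]
  · rw [if_neg hin, if_neg hin]

/-- **Off the six slots of the step, the weights do not change.** Here the six slots are
described through their endpoints: the pair is not the horizontal slot of the current face, not
the target horizontal slot (unless that slot is outside the label box), and avoids the apex
`(a − k, m + 1)`. -/
theorem StepHyp.weight_succ_of_ne (P Q : Site 2)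
    (hxy : s(P, Q) ≠ s(pt (σ.a - σ.k) (σ.j + 2 * σ.k), pt (σ.a - σ.k + 1) (σ.j + 2 * σ.k)))
    (huw : s(P, Q) ≠ s(pt (σ.a - σ.k - 1) (σ.j + 2 * σ.k + 2), pt (σ.a - σ.k) (σ.j + 2 * σ.k + 2)) ∨
      C.N < σ.j + 2 * σ.k + 2)
    (hPA : P ≠ pt (σ.a - σ.k) (σ.j + 2 * σ.k + 1)) (hQA : Q ≠ pt (σ.a - σ.k) (σ.j + 2 * σ.k + 1)) :
    weight C t σ.succ s(P, Q) = weight C t σ s(P, Q) := by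
  -- coordinates
  obtain ⟨B, M, rfl⟩ : ∃ B M, P = pt B M := ⟨P 0, P 1, (pt_eta P).symm⟩
  obtain ⟨B', M', rfl⟩ : ∃ B' M', Q = pt B' M' := ⟨Q 0, Q 1, (pt_eta Q).symm⟩
  simp only [ne_eq, Sym2.eq_iff, pt_inj] at hxy huw hPA hQA
  have hH : ∀ b m : ℤ, ¬ (b = σ.a - σ.k ∧ m = σ.j + 2 * σ.k) →
      (¬ (b = σ.a - σ.k - 1 ∧ m = σ.j + 2 * σ.k + 2) ∨ C.N < σ.j + 2 * σ.k + 2) →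
      wH C t σ.succ b m = wH C t σ b m := by
    intro b m h1 h2
    rcases h2 with h2 | h2
    · exact H.wH_succ t h1 h2
    · by_cases h3 : b = σ.a - σ.k - 1 ∧ m = σ.j + 2 * σ.k + 2
      · have : ¬ C.InBox b m := fun h => by simp only [Cfg.InBox] at h; omega
        rw [wH_eq_zero' t (fun h => this h.1), wH_eq_zero' t (fun h => this h.1)]
      · exact H.wH_succ t h1 h3
  rw [weight_pt_pt, weight_pt_pt]
  split_ifs with h1 h2 h3 h4 h5 h6
  · exact hH B M (by omega) (by omega)
  · exact hH B' M' (by omega) (by omega)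
  · exact H.wV_succ t (by omega) (by omega)
  · exact H.wV_succ t (by omega) (by omega)
  · exact H.wD_succ t (by omega) (by omega)
  · exact H.wD_succ t (by omega) (by omega)
  · rfl

end Values

/-! ### The three kinds of steps -/

section Steps

variable {C} {σ : St} (H : StepHyp C σ)
include H

/-- **A double step of the sweep is a connective equivalence** (levels `m = j + 2k ≤ N − 2`). -/
theorem StepHyp.connEquiv_succ_double (hm : σ.j + 2 * σ.k + 2 ≤ C.N)
    (ht3 : 3 * (t : ℝ) - (t : ℝ) ^ 3 = 1) (ht1 : (t : ℝ) < 1) {W : Set (Site 2)}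
    (hAW : pt (σ.a - σ.k) (σ.j + 2 * σ.k + 1) ∉ W) (hSW : spare C ∉ W) :
    ConnEquiv W (∅ : Set (Sym2 (Site 2))) (weight C t σ) (weight C t σ.succ) := by
  obtain ⟨hj1, hjN, hlo0, hL0, hk0⟩ := id H
  have e1 : pt (σ.a - σ.k) (σ.j + 2 * σ.k + 1) = pt (σ.a - σ.k - 1 + 1) (σ.j + 2 * σ.k + 1) := by
    congr 1; ring
  have e2 : σ.j + 2 * σ.k + 2 = σ.j + 2 * σ.k + 1 + 1 := by ring
  have e3 : pt (σ.a - σ.k) (σ.j + 2 * σ.k + 2) = pt (σ.a - σ.k - 1 + 1) (σ.j + 2 * σ.k + 2) := by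
    congr 1; ring
  refine connEquiv_doubleStep (x := pt (σ.a - σ.k) (σ.j + 2 * σ.k))
    (y := pt (σ.a - σ.k + 1) (σ.j + 2 * σ.k)) (A := pt (σ.a - σ.k) (σ.j + 2 * σ.k + 1))
    (u := pt (σ.a - σ.k - 1) (σ.j + 2 * σ.k + 2)) (w := pt (σ.a - σ.k) (σ.j + 2 * σ.k + 2))
    (S := spare C) ?_ ?_ ?_ ?_ ?_ ?_ ?_ ?_ ?_ ?_ ?_ ?_ ?_ ?_ ?_ hAW hSW ht3 ht1
    ?_ ?_ ?_ ?_ ?_ ?_ ?_ ?_ ?_ ?_ ?_ ?_ ?_ ?_ ?_ ?_ ?_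
  all_goals try (simp only [ne_eq, pt_inj, spare]; omega)
  · -- `p {x, y} = t`
    rw [weight_h]; exact wH_eq_t t (by simp only [Cfg.InBox, Cfg.Blo, Cfg.Bhi]; omega)
      (by simp only [Cfg.InBox, Cfg.Blo, Cfg.Bhi]; omega) H.aliveH_cur
  · -- `p {x, A} = t`
    rw [weight_v]; exact wV_eq_t t (by simp only [Cfg.InBox, Cfg.Blo, Cfg.Bhi]; omega)
      (by simp only [Cfg.InBox, Cfg.Blo, Cfg.Bhi]; omega) H.not_flagV_cur
  · -- `p {y, A} = t`
    rw [weight_d]; exact wD_eq_t t (by simp only [Cfg.InBox, Cfg.Blo, Cfg.Bhi]; omega)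
      (by simp only [Cfg.InBox, Cfg.Blo, Cfg.Bhi]; omega) H.not_flagD_cur
  · -- `p {A, u} = 1 - t`
    rw [e1, e2, weight_d]; exact wD_eq_symm t (by simp only [Cfg.InBox, Cfg.Blo, Cfg.Bhi]; omega)
      (by simp only [Cfg.InBox, Cfg.Blo, Cfg.Bhi]; omega) (H.flagD_apex (by omega))
  · -- `p {A, w} = 1 - t`
    rw [e2, weight_v]; exact wV_eq_symm t (by simp only [Cfg.InBox, Cfg.Blo, Cfg.Bhi]; omega)
      (by simp only [Cfg.InBox, Cfg.Blo, Cfg.Bhi]; omega) (H.flagV_apex (by omega))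
  · -- `p {u, w} = 0`
    rw [e3, weight_h]; exact wH_eq_zero t H.not_aliveH_target
  · -- the apex has no other edge
    intro z h1 h2 h3 h4
    obtain ⟨zb, zm, rfl⟩ : ∃ zb zm, z = pt zb zm := ⟨z 0, z 1, (pt_eta z).symm⟩
    simp only [ne_eq, pt_inj] at h1 h2 h3 h4
    rw [weight_pt_pt]
    split_ifs with c1 c2 c3 c4 c5 c6
    · exact wH_eq_zero t (H.not_aliveH_apex_level (by omega) (by omega))
    · obtain ⟨hc, hc'⟩ := c2
      rw [← hc']
      exact wH_eq_zero t (H.not_aliveH_apex_level (by omega) (by omega))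
    · exfalso; omega
    · exfalso; omega
    · exfalso; omega
    · exfalso; omega
    · rfl
  · exact fun z => weight_spare t σ z
  · -- `p' {x, y} = 0`
    rw [weight_h]; exact wH_eq_zero t (H.not_aliveH_cur_succ (by omega))
  · rw [weight_v]; exact wV_eq_symm t (by simp only [Cfg.InBox, Cfg.Blo, Cfg.Bhi]; omega)
      (by simp only [Cfg.InBox, Cfg.Blo, Cfg.Bhi]; omega) (H.flagV_cur_succ (by omega))
  · rw [weight_d]; exact wD_eq_symm t (by simp only [Cfg.InBox, Cfg.Blo, Cfg.Bhi]; omega)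
      (by simp only [Cfg.InBox, Cfg.Blo, Cfg.Bhi]; omega) (H.flagD_cur_succ (by omega))
  · rw [e1, e2, weight_d]; exact wD_eq_t t (by simp only [Cfg.InBox, Cfg.Blo, Cfg.Bhi]; omega)
      (by simp only [Cfg.InBox, Cfg.Blo, Cfg.Bhi]; omega) (H.not_flagD_apex_succ (by omega))
  · rw [e2, weight_v]; exact wV_eq_t t (by simp only [Cfg.InBox, Cfg.Blo, Cfg.Bhi]; omega)
      (by simp only [Cfg.InBox, Cfg.Blo, Cfg.Bhi]; omega) (H.not_flagV_apex_succ (by omega))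
  · rw [e3, weight_h]; exact wH_eq_t t (by simp only [Cfg.InBox, Cfg.Blo, Cfg.Bhi]; omega)
      (by simp only [Cfg.InBox, Cfg.Blo, Cfg.Bhi]; omega) H.aliveH_target_succ
  · intro z h1 h2 h3 h4
    obtain ⟨zb, zm, rfl⟩ : ∃ zb zm, z = pt zb zm := ⟨z 0, z 1, (pt_eta z).symm⟩
    simp only [ne_eq, pt_inj] at h1 h2 h3 h4
    rw [weight_pt_pt]
    split_ifs with c1 c2 c3 c4 c5 c6
    · exact wH_eq_zero t (H.not_aliveH_apex_level_succ (by omega) (by omega))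
    · obtain ⟨hc, hc'⟩ := c2
      rw [← hc']
      exact wH_eq_zero t (H.not_aliveH_apex_level_succ (by omega) (by omega))
    · exfalso; omega
    · exfalso; omega
    · exfalso; omega
    · exfalso; omega
    · rfl
  · exact fun z => weight_spare t σ.succ z
  · intro P Q hne1 hne2 hPA hQA _ _
    exact H.weight_succ_of_ne t P Q hne1 (Or.inl hne2) hPA hQA

/-- **A half step of the sweep is a connective equivalence** (level `m = j + 2k = N − 1`). -/
theorem StepHyp.connEquiv_succ_half (hm : σ.j + 2 * σ.k + 1 = C.N)
    (ht3 : 3 * (t : ℝ) - (t : ℝ) ^ 3 = 1) (ht1 : (t : ℝ) < 1) {W : Set (Site 2)}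
    (hAW : pt (σ.a - σ.k) (σ.j + 2 * σ.k + 1) ∉ W) (hSW : spare C ∉ W) :
    ConnEquiv W (∅ : Set (Sym2 (Site 2))) (weight C t σ) (weight C t σ.succ) := by
  obtain ⟨hj1, hjN, hlo0, hL0, hk0⟩ := id H
  refine connEquiv_halfStep (x := pt (σ.a - σ.k) (σ.j + 2 * σ.k))
    (y := pt (σ.a - σ.k + 1) (σ.j + 2 * σ.k)) (A := pt (σ.a - σ.k) (σ.j + 2 * σ.k + 1))
    (S := spare C) ?_ ?_ ?_ ?_ ?_ ?_ hAW hSW ht3 ht1 ?_ ?_ ?_ ?_ ?_ ?_ ?_ ?_ ?_ ?_ ?_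
  all_goals try (simp only [ne_eq, pt_inj, spare]; omega)
  · rw [weight_h]; exact wH_eq_t t (by simp only [Cfg.InBox, Cfg.Blo, Cfg.Bhi]; omega)
      (by simp only [Cfg.InBox, Cfg.Blo, Cfg.Bhi]; omega) H.aliveH_cur
  · rw [weight_v]; exact wV_eq_t t (by simp only [Cfg.InBox, Cfg.Blo, Cfg.Bhi]; omega)
      (by simp only [Cfg.InBox, Cfg.Blo, Cfg.Bhi]; omega) H.not_flagV_cur
  · rw [weight_d]; exact wD_eq_t t (by simp only [Cfg.InBox, Cfg.Blo, Cfg.Bhi]; omega)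
      (by simp only [Cfg.InBox, Cfg.Blo, Cfg.Bhi]; omega) H.not_flagD_cur
  · -- the apex has no other edge
    intro z h1 h2
    obtain ⟨zb, zm, rfl⟩ : ∃ zb zm, z = pt zb zm := ⟨z 0, z 1, (pt_eta z).symm⟩
    simp only [ne_eq, pt_inj] at h1 h2
    rw [weight_pt_pt]
    split_ifs with c1 c2 c3 c4 c5 c6
    · exact wH_eq_zero t (H.not_aliveH_apex_level (by omega) (by omega))
    · obtain ⟨hc, hc'⟩ := c2
      rw [← hc']
      exact wH_eq_zero t (H.not_aliveH_apex_level (by omega) (by omega))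
    · exact wV_eq_zero t (fun h => by simp only [Cfg.InBox] at h; omega)
    · exfalso; omega
    · exact wD_eq_zero t (fun h => by simp only [Cfg.InBox] at h; omega)
    · exfalso; omega
    · rfl
  · exact fun z => weight_spare t σ z
  · rw [weight_h]; exact wH_eq_zero t (H.not_aliveH_cur_succ (by omega))
  · rw [weight_v]; exact wV_eq_symm t (by simp only [Cfg.InBox, Cfg.Blo, Cfg.Bhi]; omega)
      (by simp only [Cfg.InBox, Cfg.Blo, Cfg.Bhi]; omega) (H.flagV_cur_succ (by omega))
  · rw [weight_d]; exact wD_eq_symm t (by simp only [Cfg.InBox, Cfg.Blo, Cfg.Bhi]; omega)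
      (by simp only [Cfg.InBox, Cfg.Blo, Cfg.Bhi]; omega) (H.flagD_cur_succ (by omega))
  · intro z h1 h2
    obtain ⟨zb, zm, rfl⟩ : ∃ zb zm, z = pt zb zm := ⟨z 0, z 1, (pt_eta z).symm⟩
    simp only [ne_eq, pt_inj] at h1 h2
    rw [weight_pt_pt]
    split_ifs with c1 c2 c3 c4 c5 c6
    · exact wH_eq_zero t (H.not_aliveH_apex_level_succ (by omega) (by omega))
    · obtain ⟨hc, hc'⟩ := c2
      rw [← hc']
      exact wH_eq_zero t (H.not_aliveH_apex_level_succ (by omega) (by omega))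
    · exact wV_eq_zero t (fun h => by simp only [Cfg.InBox] at h; omega)
    · exfalso; omega
    · exact wD_eq_zero t (fun h => by simp only [Cfg.InBox] at h; omega)
    · exfalso; omega
    · rfl
  · exact fun z => weight_spare t σ.succ z
  · intro P Q hne1 hPA hQA _ _
    exact H.weight_succ_of_ne t P Q hne1 (Or.inr (by omega)) hPA hQA

/-- At the top level the step only deletes the travelling edge: no face is stepped … -/
theorem StepHyp.doneFace_succ_iff_top (hm : C.N ≤ σ.j + 2 * σ.k) (b m r : ℤ) :
    DoneFace C σ.succ b m r ↔ DoneFace C σ b m r := by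
  rw [doneFace_succ_iff σ H.k_nonneg]
  constructor
  · rintro (h | ⟨-, -, h1, -, h2, -⟩)
    · exact h
    · omega
  · exact Or.inl

/-- … so the flags do not change … -/
theorem StepHyp.wV_succ_top (hm : C.N ≤ σ.j + 2 * σ.k) (b m : ℤ) : wV C t σ.succ b m = wV C t σ b m := by
  have hf : FlagV C σ.succ b m ↔ FlagV C σ b m := by
    simp only [FlagV, H.doneFace_succ_iff_top hm]
  unfold wV
  by_cases hin : C.InBox b m ∧ C.InBox b (m + 1)
  · rw [if_pos hin, if_pos hin]
    by_cases h : FlagV C σ b m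
    · rw [if_pos h, if_pos (hf.2 h)]
    · rw [if_neg h, if_neg (fun h' => h (hf.1 h'))]
  · rw [if_neg hin, if_neg hin]

/-- … (`d`-slots) … -/
theorem StepHyp.wD_succ_top (hm : C.N ≤ σ.j + 2 * σ.k) (b m : ℤ) : wD C t σ.succ b m = wD C t σ b m := by
  have hf : FlagD C σ.succ b m ↔ FlagD C σ b m := by
    simp only [FlagD, H.doneFace_succ_iff_top hm]
  unfold wD
  by_cases hin : C.InBox (b + 1) m ∧ C.InBox b (m + 1)
  · rw [if_pos hin, if_pos hin]
    by_cases h : FlagD C σ b m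
    · rw [if_pos h, if_pos (hf.2 h)]
    · rw [if_neg h, if_neg (fun h' => h (hf.1 h'))]
  · rw [if_neg hin, if_neg hin]

/-- … and the horizontal weights can only decrease. -/
theorem StepHyp.wH_succ_top_le (hm : C.N ≤ σ.j + 2 * σ.k) (b m : ℤ) : wH C t σ.succ b m ≤ wH C t σ b m := by
  unfold wH
  by_cases h' : C.InBox b m ∧ C.InBox (b + 1) m ∧ AliveH C σ.succ b m
  · have h : C.InBox b m ∧ C.InBox (b + 1) m ∧ AliveH C σ b m := by
      refine ⟨h'.1, h'.2.1, ?_⟩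
      rcases h'.2.2 with ⟨h1, h2⟩ | ⟨-, -, h3⟩
      · exact Or.inl ⟨h1, fun hd => h2 ((H.doneFace_succ_iff_top hm _ _ _).2 hd)⟩
      · exfalso
        have := h'.1
        simp only [Cfg.InBox, St.succ] at this h3; omega
    rw [if_pos h', if_pos h]
  · rw [if_neg h']; exact bot_le

/-- **The deletion step at the top level decreases the weights.** -/
theorem StepHyp.weight_succ_le_top (hm : C.N ≤ σ.j + 2 * σ.k) : weight C t σ.succ ≤ weight C t σ := by
  intro e
  induction e using Sym2.ind with
  | h P Q =>
    obtain ⟨B, M, rfl⟩ : ∃ B M, P = pt B M := ⟨P 0, P 1, (pt_eta P).symm⟩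
    obtain ⟨B', M', rfl⟩ : ∃ B' M', Q = pt B' M' := ⟨Q 0, Q 1, (pt_eta Q).symm⟩
    rw [weight_pt_pt, weight_pt_pt]
    split_ifs
    · exact H.wH_succ_top_le t hm _ _
    · exact H.wH_succ_top_le t hm _ _
    · exact (H.wV_succ_top t hm _ _).le
    · exact (H.wV_succ_top t hm _ _).le
    · exact (H.wD_succ_top t hm _ _).le
    · exact (H.wD_succ_top t hm _ _).le
    · exact le_rfl

end Steps

end Summit.CriticalPhenomena.CardyFormulaZ2.Theorems.TriSweep

end
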